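import Summits.QuantumFields.YangMills.Theorems.BalabanUVNodesK1R9VersionSlotOfAEAtRecord

/-!
# BalabanUVNodes ∕ N13 — THE TWO (δ) DISPLAYS OF THE K1 (B)-CONJUNCT ARE EQUIVALENT AT THE RECORD (kernel statement for plan g85's shape sheet ∕ the director's pick):
# `∃ v : Node00.Revision₁₃ F 2 θ h, B16.EndStatementBPrinted (Node00.datumOfRecord₁₃SepCoPHV F 2 θ h v).C`   (the (δⱽ) VERSION-SLOT display, B16's pointwise letter verbatim)
# ⟺ `B16.Thm1Printed (datum).C ∧ ∃ γ > 0, ∃ em ep, (2.50) at EVERY field of level 0 ∧ for dV_k-ALMOST EVERY field at levels 1…K on the γ-window`   (the №210-letter (B)ᴬᴱ display)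

Cell `pub-ymgap` (HUMAN RULING D-0062 Track A ∕ D-0149 width), WIDTH SEAT `pub-ymgap-dag-n13-w1` (gen 5, CLAIM-5), key K1⁸ `StabilityBRunRowsAtRecordR13SepCoPH` = stmt-QuantumFields-26907
(`--kind proof --supports … --as helper`; count-neutral).  ROUTE-FREE (imports this seat's route-free junction p622796 only, hence p620313 + DEF-1's p620607).
Forward («a.e. ⟹ slot») is this seat's junction `K1R9VersionSlotOfAEAtRecord.exists_revision₁₃_endStatementBPrinted_of_aeDisplay` (the datum surgery); backward («slot ⟹ a.e.») is the
trivial direction: a revision's densities EQUAL the record's at level 0 (`TowerRevision.rho_zero_eq`) and agree `dV_k`-a.e. at every level `k+1 ≤ K` (`TowerRevision.ae_eq_succ`), and (2.50) at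
`(core).construction ρ p` reads `ρ p k V` only through its one value (`TowerReviseAE.uvIneq_construction_iff`) — so (B) AS TYPED at `datumⱽ θ h v` gives the a.e. display at the record with
the SAME exponents.  Hence the director's pick between the two spellings (plan g84 ■ CLOSE ∕ WORD-3b, DEF-1's preview `closesV`) is a pick of DISPLAY only: the K1 (B)-conjuncts carry the
same content.
[III] = [Balaban1988Convergent], [B16] = [Balaban1989LargeFieldII].

WHAT.  `uvIneq_record_zero_of_revision` (level 0: (2.50) at `datumⱽ v` ⟹ at the record, every field), `ae_uvIneq_record_succ_of_revision` (levels `k+1 ≤ K`: ⟹ `dV_{k+1}`-a.e. at the record),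
★★ `aeDisplay_of_exists_revision₁₃_endStatementBPrinted` (slot ⟹ a.e. display, same `γ em ep`), ★★★ `exists_revision₁₃_endStatementBPrinted_iff_aeDisplay` (the equivalence); §3 ★★
`k3V_of_k3AEBody` (K3 side: a supplier of the apex BODY from the a.e. display + END at the record serves the slot-keyed K3⁸ text for EVERY revision `v` — DEF-1's
`hybridNE7Under_datumOfRecord₁₃SepCoPHV_iff` ∕ `endpointExistence_datumOfRecord₁₃SepCoPHV_iff`).

HONEST FRAMING.  Count-neutral kernel bookkeeping over the landed files; nothing of Bałaban's asserted or refuted; neither display is PROVED here (both are the K1 item's open (B)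
conjunct in the (δ) shape); K1⁸ ∕ K1⁹ NEITHER proved NOR refuted; N13 NOT discharged; no stub closed; counts unmoved (typed 28∕28 · discharged 5∕27, A 5∕28); one finite `𝕋⁴_{L^K}` programme
at fixed ε; R4 closes the CONDITIONAL finite-𝕋⁴ rung `BalabanLadder.UV` only — the Yang–Mills mass gap (Clay) is NOT proved by any of this.  No `sorry`, `def`, `instance`, `notation`; standard axioms.
-/

noncomputable section

open scoped BigOperators ENNReal NNReal Matrix.Norms.L2Operator

namespace Summit.QuantumFields.YangMills.BalabanUVNodes.K1R9VersionSlotIffAEDisplayAtRecord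

open MeasureTheory
open Literature.MathematicalPhysics.QuantumFieldTheory.Balaban1983to89
open Literature.MathematicalPhysics.QuantumFieldTheory.Balaban1983to89.T4Continuum (T4Family FiniteEpsData)
open Literature.MathematicalPhysics.QuantumFieldTheory.Balaban1983to89.Node00
open Literature.MathematicalPhysics.QuantumFieldTheory.Balaban1983to89.T4DatumAssembly.TowerReviseAE (uvIneq_construction_iff)
open Summit.QuantumFields.YangMills.BalabanUVNodes.K1R9VersionSlotOfAEAtRecord (exists_revision₁₃_endStatementBPrinted_of_aeDisplay)

variable {F : T4Family}

/-! ## §1 (2.50) at a revised datum ⟹ (2.50) at the record: every field at level 0, `dV`-a.e. at levels `k+1 ≤ K` -/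

/-- **Level 0**: a revision's level-0 density IS the record's (`TowerRevision.rho_zero_eq`), so (2.50) at level 0 transfers field by field with the same exponents.
[cite: Balaban1989LargeFieldII, (0.1) pp.355–356; Balaban1988Convergent, Thm 1 p.262 (bookkeeping)] -/
theorem uvIneq_record_zero_of_revision (θ : Stage13HParams F 2) (h : θ.Provisos₁₃SepCoPH F 2) (v : Revision₁₃ F 2 θ h) (p : B12.RunParams)
    (V : GaugeField (F.P p.K) 0 (SU 2)) {Em Ep : ℝ} (hV : B16.UVIneq ((datumOfRecord₁₃SepCoPHV F 2 θ h v).C p) 0 V Em Ep) :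
    B16.UVIneq ((datumOfRecord₁₃SepCoPH F 2 θ h).C p) 0 V Em Ep := by
  have h' : B16.UVIneq ((coreOfRecord₁₃CoPH F 2 θ).construction v.ρ p) 0 V Em Ep := hV
  rw [uvIneq_construction_iff, v.rho_zero_eq p] at h'
  exact (uvIneq_construction_iff (coreOfRecord₁₃CoPH F 2 θ) (towerOfRecord₁₃SepCoPH F 2 θ h).ρ p 0 V Em Ep).mpr h'

/-- **Levels `k+1 ≤ K`**: a revision's density agrees with the record's `dV_{k+1}`-a.e. (`TowerRevision.ae_eq_succ`), so (2.50) at EVERY field for the revision gives (2.50) for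
`dV_{k+1}`-ALMOST EVERY field at the record, same exponents. [cite: Balaban1989LargeFieldII, (0.1) pp.355–356; Balaban1988Convergent, Cor. 3 (2.50) p.264 (bookkeeping)] -/
theorem ae_uvIneq_record_succ_of_revision (θ : Stage13HParams F 2) (h : θ.Provisos₁₃SepCoPH F 2) (v : Revision₁₃ F 2 θ h) (p : B12.RunParams) (k : ℕ)
    (hk : k + 1 ≤ p.K) {Em Ep : ℝ} (hV : ∀ V : GaugeField (F.P p.K) (k + 1) (SU 2), B16.UVIneq ((datumOfRecord₁₃SepCoPHV F 2 θ h v).C p) (k + 1) V Em Ep) :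
    ∀ᵐ V ∂fieldMeasure (F.P p.K) (k + 1) (SU 2), B16.UVIneq ((datumOfRecord₁₃SepCoPH F 2 θ h).C p) (k + 1) V Em Ep := by
  filter_upwards [v.ae_eq_succ p k hk] with V hVeq
  have h' : B16.UVIneq ((coreOfRecord₁₃CoPH F 2 θ).construction v.ρ p) (k + 1) V Em Ep := hV V
  rw [uvIneq_construction_iff, hVeq] at h'
  exact (uvIneq_construction_iff (coreOfRecord₁₃CoPH F 2 θ) (towerOfRecord₁₃SepCoPH F 2 θ h).ρ p (k + 1) V Em Ep).mpr h'

/-! ## §2 The version-slot display ⟹ the a.e. display; the equivalence -/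

/-- **★★ THE (δⱽ) VERSION-SLOT DISPLAY ⟹ THE №210-LETTER A.E. DISPLAY** (same `γ em ep`): from `B16.EndStatementBPrinted (datumOfRecord₁₃SepCoPHV F 2 θ h v).C` for SOME revision `v`,
Theorem 1's clause at the record (`thm1Printed_datumOfRecord₁₃SepCoPHV_iff`) and (2.50) on the γ-window at EVERY field of level 0 and for `dV_k`-ALMOST EVERY field at levels `1 ≤ k ≤ K`.
[cite: Balaban1989LargeFieldII, Thm 1 + (0.1) pp.355–356; Balaban1988Convergent, Cor. 3 (2.50) p.264 (bookkeeping)] -/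
theorem aeDisplay_of_exists_revision₁₃_endStatementBPrinted (θ : Stage13HParams F 2) (h : θ.Provisos₁₃SepCoPH F 2)
    (hB : ∃ v : Revision₁₃ F 2 θ h, B16.EndStatementBPrinted (datumOfRecord₁₃SepCoPHV F 2 θ h v).C) :
    B16.Thm1Printed (datumOfRecord₁₃SepCoPH F 2 θ h).C ∧
      ∃ γ : ℝ, 0 < γ ∧ ∃ em ep : ℝ → ℝ,
        (∀ p : B12.RunParams, ((datumOfRecord₁₃SepCoPH F 2 θ h).C p).flow.InInterval γ p.K →
          ∀ V : GaugeField (F.P p.K) 0 (SU 2),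
            B16.UVIneq ((datumOfRecord₁₃SepCoPH F 2 θ h).C p) 0 V (em (((datumOfRecord₁₃SepCoPH F 2 θ h).C p).flow.g 0))
              (ep (((datumOfRecord₁₃SepCoPH F 2 θ h).C p).flow.g 0))) ∧
        (∀ p : B12.RunParams, ((datumOfRecord₁₃SepCoPH F 2 θ h).C p).flow.InInterval γ p.K → ∀ k : ℕ, k + 1 ≤ p.K →
          ∀ᵐ V ∂fieldMeasure (F.P p.K) (k + 1) (SU 2),
            B16.UVIneq ((datumOfRecord₁₃SepCoPH F 2 θ h).C p) (k + 1) V (em (((datumOfRecord₁₃SepCoPH F 2 θ h).C p).flow.g (k + 1)))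
              (ep (((datumOfRecord₁₃SepCoPH F 2 θ h).C p).flow.g (k + 1)))) := by
  obtain ⟨v, h1, γ, hγ, em, ep, hcor⟩ := hB
  refine ⟨(thm1Printed_datumOfRecord₁₃SepCoPHV_iff F 2 θ h v).mp h1, γ, hγ, em, ep, fun p hp V => ?_, fun p hp k hk => ?_⟩
  · exact uvIneq_record_zero_of_revision θ h v p V (hcor p hp 0 (Nat.zero_le _) V)
  · exact ae_uvIneq_record_succ_of_revision θ h v p k hk (fun V => hcor p hp (k + 1) hk V)

/-- **★★★ THE TWO (δ) DISPLAYS OF THE K1 (B)-CONJUNCT ARE EQUIVALENT AT THE RECORD**: `(∃ v, B16.EndStatementBPrinted (datumOfRecord₁₃SepCoPHV F 2 θ h v).C) ↔ (Thm1 ∧ ∃ γ em ep,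
(2.50) pointwise@0 ∧ a.e.@levels 1…K on the γ-window)`.  Forward = the trivial direction (§1, same exponents); backward = this seat's datum-surgery junction (p622796 ∘ p620313 ∘ DEF-1's
p620607; the upper exponent becomes `max ep (−em)` inside the ∃).  So the director's pick between the (δⱽ) slot spelling and the №210-letter a.e. spelling is a pick of DISPLAY only.
[cite: Balaban1989LargeFieldII, Thm 1 + (0.1) pp.355–356; Balaban1988Convergent, Cor. 3 (2.50) p.264, (0.2) p.244 (bookkeeping)] -/
theorem exists_revision₁₃_endStatementBPrinted_iff_aeDisplay (θ : Stage13HParams F 2) (h : θ.Provisos₁₃SepCoPH F 2) :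
    (∃ v : Revision₁₃ F 2 θ h, B16.EndStatementBPrinted (datumOfRecord₁₃SepCoPHV F 2 θ h v).C) ↔
      (B16.Thm1Printed (datumOfRecord₁₃SepCoPH F 2 θ h).C ∧
        ∃ γ : ℝ, 0 < γ ∧ ∃ em ep : ℝ → ℝ,
          (∀ p : B12.RunParams, ((datumOfRecord₁₃SepCoPH F 2 θ h).C p).flow.InInterval γ p.K →
            ∀ V : GaugeField (F.P p.K) 0 (SU 2),
              B16.UVIneq ((datumOfRecord₁₃SepCoPH F 2 θ h).C p) 0 V (em (((datumOfRecord₁₃SepCoPH F 2 θ h).C p).flow.g 0))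
                (ep (((datumOfRecord₁₃SepCoPH F 2 θ h).C p).flow.g 0))) ∧
          (∀ p : B12.RunParams, ((datumOfRecord₁₃SepCoPH F 2 θ h).C p).flow.InInterval γ p.K → ∀ k : ℕ, k + 1 ≤ p.K →
            ∀ᵐ V ∂fieldMeasure (F.P p.K) (k + 1) (SU 2),
              B16.UVIneq ((datumOfRecord₁₃SepCoPH F 2 θ h).C p) (k + 1) V (em (((datumOfRecord₁₃SepCoPH F 2 θ h).C p).flow.g (k + 1)))
                (ep (((datumOfRecord₁₃SepCoPH F 2 θ h).C p).flow.g (k + 1))))) :=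
  ⟨aeDisplay_of_exists_revision₁₃_endStatementBPrinted θ h, exists_revision₁₃_endStatementBPrinted_of_aeDisplay θ h⟩

/-! ## §3 The K3 side: a supplier of the apex BODY from the a.e. display serves the slot-keyed K3 text -/

/-- **★★ THE №210-LETTER K3 (apex BODY from the a.e. display) ⟹ THE SLOT-KEYED K3⁸ TEXT.**  If for every `(θ, h)` with unity ∕ admissibility the a.e. display of (B) and
`EndpointExistence` at the record give the BODY of `T4ApexHybrid.HybridNE7Under` at the record (the K3 lanes' natural target: their estimates are integral-level), then the
slot-keyed K3⁸ candidate holds: for every revision `v`, (B) AS TYPED at `datumOfRecord₁₃SepCoPHV θ h v` ⟹ the a.e. display at the record (§2), `EndpointExistence` is version-free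
(DEF-1's `endpointExistence_datumOfRecord₁₃SepCoPHV_iff`), and `HybridNE7Under (datumⱽ v) …` IS «(B) at the slot → Hβ → BODY at the record» (DEF-1's `hybridNE7Under_datumOfRecord₁₃SepCoPHV_iff`).
[cite: Balaban1989LargeFieldII, (0.1) p.356; Balaban1987RG1, Thm 2 p.259 (bookkeeping; a composition of displayed texts)] -/
theorem k3V_of_k3AEBody
    (h3 : ∀ (F : T4Family) (θ : Stage13HParams F 2) (h : θ.Provisos₁₃SepCoPH F 2), (θ.ZhUnity F 2 ∧ θ.SlotsNondegenerate₁₃ F 2) → θ.Admissible F 2 →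
      (B16.Thm1Printed (datumOfRecord₁₃SepCoPH F 2 θ h).C ∧
          ∃ γ : ℝ, 0 < γ ∧ ∃ em ep : ℝ → ℝ,
            (∀ p : B12.RunParams, ((datumOfRecord₁₃SepCoPH F 2 θ h).C p).flow.InInterval γ p.K →
              ∀ V : GaugeField (F.P p.K) 0 (SU 2),
                B16.UVIneq ((datumOfRecord₁₃SepCoPH F 2 θ h).C p) 0 V (em (((datumOfRecord₁₃SepCoPH F 2 θ h).C p).flow.g 0))
                  (ep (((datumOfRecord₁₃SepCoPH F 2 θ h).C p).flow.g 0))) ∧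
            (∀ p : B12.RunParams, ((datumOfRecord₁₃SepCoPH F 2 θ h).C p).flow.InInterval γ p.K → ∀ k : ℕ, k + 1 ≤ p.K →
              ∀ᵐ V ∂fieldMeasure (F.P p.K) (k + 1) (SU 2),
                B16.UVIneq ((datumOfRecord₁₃SepCoPH F 2 θ h).C p) (k + 1) V (em (((datumOfRecord₁₃SepCoPH F 2 θ h).C p).flow.g (k + 1)))
                  (ep (((datumOfRecord₁₃SepCoPH F 2 θ h).C p).flow.g (k + 1))))) →
      DagBinding.EndpointExistence (datumOfRecord₁₃SepCoPH F 2 θ h).C.toB12 →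
      ∃ γ₀ : ℝ, 0 < γ₀ ∧ ∀ γ : ℝ, 0 < γ → γ ≤ γ₀ → ∃ g₁ : ℝ, 0 < g₁ ∧ ∀ g : ℝ, 0 < g → g ≤ g₁ →
        ∀ g₀ : ℕ → ℝ, (datumOfRecord₁₃SepCoPH F 2 θ h).Tuned γ g g₀ →
          T4ApexHybrid.StringwiseHybridNE7 ((datumOfRecord₁₃SepCoPH F 2 θ h).scheme g₀)) :
    ∀ (F : T4Family) (θ : Stage13HParams F 2) (h : θ.Provisos₁₃SepCoPH F 2) (v : Revision₁₃ F 2 θ h),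
      (θ.ZhUnity F 2 ∧ θ.SlotsNondegenerate₁₃ F 2) → θ.Admissible F 2 →
      B16.EndStatementBPrinted (datumOfRecord₁₃SepCoPHV F 2 θ h v).C →
      DagBinding.EndpointExistence (datumOfRecord₁₃SepCoPHV F 2 θ h v).C.toB12 →
      T4ApexHybrid.HybridNE7Under (datumOfRecord₁₃SepCoPHV F 2 θ h v)
        (DagBinding.EndpointExistence (datumOfRecord₁₃SepCoPHV F 2 θ h v).C.toB12) := by
  intro F θ h v hU hθ hB hend
  rw [hybridNE7Under_datumOfRecord₁₃SepCoPHV_iff]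
  intro _ _
  exact h3 F θ h hU hθ (aeDisplay_of_exists_revision₁₃_endStatementBPrinted θ h ⟨v, hB⟩)
    ((endpointExistence_datumOfRecord₁₃SepCoPHV_iff F 2 θ h v).mp hend)

end Summit.QuantumFields.YangMills.BalabanUVNodes.K1R9VersionSlotIffAEDisplayAtRecord

end
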